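import Mathlib.LinearAlgebra.FiniteDimensional.Basic
import Mathlib.LinearAlgebra.Dimension.Constructions
import Mathlib.FieldTheory.Minpoly.Field
import Mathlib.RingTheory.PrincipalIdealDomain
import Mathlib.Algebra.Polynomial.Div
import Mathlib.Algebra.Polynomial.Inductions
import HarnessLib

/-!
# A point of a commutative algebra of endomorphisms is the eigensystem of a common eigenvector

Topic `NumberTheory/Automorphic` (Hecke algebras); theorems only.  Proof file supporting the named
fact `Literature.NumberTheory.Automorphic.hidaControl_dominantOrdinaryPoint` (Hida's control theorem
in consequence form): the LAST STEP of the printed argument, pure linear algebra — once a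
`ℚ̄_p`-point `x` of the ordinary Hecke algebra is known to factor through the (commutative) Hecke
algebra `h_κ(U; E)` ACTING FAITHFULLY on the finite-dimensional classical cohomology
`H^q_ord(X_U, L(κ; E))` ([Hida1994AIF, Thm. 3.1–3.2]: "`h_κ^{n.ord}` acts faithfully on `M`";
[KhareThorne2017, §6.5 Lemma 6.16–6.17]: "every maximal ideal of `𝕋^S_ord(U)` appears in the
support of … `H_*(X_U, k)_ord`"), the eigensystem `x` is realised on a NON-ZERO SIMULTANEOUS
EIGENVECTOR.  In the generality proved here:

* `exists_map_eq_one_and_pow_mul_eq_zero` — in a finite-dimensional algebra `A` over a field `E`,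
  an element `f` in the kernel of a character `x : A →ₐ[E] E` admits `e ∈ E[f]` with `x e = 1` and
  `f^k e = 0` for some `k` (Bezout for the minimal polynomial `μ_f = X^k g`, `g(0) ≠ 0`, `k ≥ 1`
  because an `f` with `μ_f(0) ≠ 0` is invertible in `E[f]`, contradicting `x f = 0`).
* `exists_ne_zero_forall_apply_eq_smul_of_algHom` — **for a COMMUTATIVE subalgebra
  `A ⊆ End_E(V)` of the endomorphisms of a finite-dimensional vector space `V` and ANY `E`-algebra
  homomorphism `x : A → E`, there is `v ≠ 0` with `a v = x(a) v` for all `a ∈ A`** (the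
  maximal ideal `ker x` lies in the support of the faithful module `V`: with `f_i = b_i − x(b_i)`
  for a basis `b_i` of `A`, the product `e` of the elements attached to the `f_i` has `x e = 1`,
  hence `e ≠ 0`, its image is `A`-stable and killed by powers of every `f_i`, and commuting
  nilpotent endomorphisms of a non-zero space have a common kernel vector).

## References

* H. Hida, *p-adic ordinary Hecke algebras for GL(2)*, Ann. Inst. Fourier 44 (1994), §3,
  Thm. 3.1–3.2 (held; read 2026-08-16). [Hida1994AIF]
* C. Khare, J. A. Thorne, *Potential automorphy and the Leopoldt conjecture*, Amer. J. Math. 139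
  (2017), §6.5 Lemma 6.16–6.17 (arXiv:1409.7007, held; read 2026-08-16). [KhareThorne2017]
* D. Eisenbud, *Commutative Algebra with a View Toward Algebraic Geometry*, GTM 150 (1995), §2.4
  and Cor. 2.19 (support and associated points; the reference "[Eis95]" of Lemma 6.16).
  [Eisenbud1995]
-/

noncomputable section

open Polynomial

namespace Literature.NumberTheory.Automorphic

/-! ### An element in the kernel of a character: `e ∈ E[f]` with `x e = 1`, `f^k e = 0` -/

section Character

variable {E A : Type*} [Field E] [Ring A] [Algebra E A] [FiniteDimensional E A]

/-- **In a finite-dimensional algebra, an element `f` with `x f = 0` for a character `x : A → E`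
admits `e ∈ E[f]` with `x e = 1` and `f ^ k e = 0`.**  Write the minimal polynomial as
`μ_f = X^k g` with `g(0) ≠ 0`; Bezout `u X^k + w g = 1` gives `e = (w g)(f)`; and `k ≥ 1` since
otherwise `f` is invertible in `E[f]` and `1 = x(f⁻¹) x(f) = 0`. [folklore] -/
theorem exists_map_eq_one_and_pow_mul_eq_zero (x : A →ₐ[E] E) (f : A) (hf : x f = 0) :
    ∃ (e : A) (k : ℕ), x e = 1 ∧ f ^ k * e = 0 ∧ Commute f e := by
  have hint : IsIntegral E f := Algebra.IsIntegral.isIntegral f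
  have hμ0 : minpoly E f ≠ 0 := minpoly.ne_zero hint
  have hμf : aeval f (minpoly E f) = 0 := minpoly.aeval E f
  obtain ⟨g, hμg, hndvd⟩ :=
    Polynomial.exists_eq_pow_rootMultiplicity_mul_and_not_dvd (minpoly E f) hμ0 0
  rw [map_zero, sub_zero] at hμg hndvd
  set k := (minpoly E f).rootMultiplicity 0 with hk
  -- polynomials in `f` commute with `f`
  have hcomm : ∀ r : E[X], Commute f (aeval f r) := fun r => by
    have h : aeval f (X * r) = aeval f (r * X) := by rw [mul_comm]
    rw [map_mul, map_mul, aeval_X] at h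
    exact h
  -- `k ≥ 1`: otherwise `f` is invertible in `E[f]`, contradicting `x f = 0`
  have hk1 : 1 ≤ k := by
    by_contra hk0
    have hk0' : k = 0 := by omega
    rw [hk0', pow_zero, one_mul] at hμg
    set c : E := (minpoly E f).coeff 0 with hc
    have hc0 : c ≠ 0 := fun h => hndvd (hμg ▸ Polynomial.X_dvd_iff.2 h)
    have hXq : (X : E[X]) * (-C c⁻¹ * (minpoly E f).divX) = 1 - C c⁻¹ * minpoly E f := by
      have h := Polynomial.divX_mul_X_add (minpoly E f)
      rw [← hc] at h
      have h1 : C c⁻¹ * C c = (1 : E[X]) := by rw [← C_mul, inv_mul_cancel₀ hc0, C_1]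
      linear_combination (-(C c⁻¹)) * h + h1
    have hinv : f * aeval f (-C c⁻¹ * (minpoly E f).divX) = 1 := by
      have h := congrArg (aeval f) hXq
      rwa [map_mul, aeval_X, map_sub, map_one, map_mul (aeval f) (C c⁻¹) (minpoly E f), hμf,
        mul_zero, sub_zero] at h
    have h := congrArg x hinv
    rw [map_mul, hf, zero_mul, map_one] at h
    exact zero_ne_one h
  -- Bezout
  obtain ⟨u, w, huw⟩ : IsCoprime (X ^ k : E[X]) g :=
    (Polynomial.irreducible_X.coprime_iff_not_dvd.2 hndvd).pow_left
  refine ⟨aeval f (w * g), k, ?_, ?_, hcomm _⟩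
  · have h1 : aeval f (u * X ^ k) + aeval f (w * g) = 1 := by rw [← map_add, huw, map_one]
    have hx := congrArg x h1
    rw [map_add, map_one, map_mul (aeval f), map_pow, aeval_X, map_mul x, map_pow x, hf,
      zero_pow (by omega), mul_zero, zero_add] at hx
    exact hx
  · have h : (X : E[X]) ^ k * (w * g) = w * minpoly E f := by rw [hμg]; ring
    have h' := congrArg (aeval f) h
    rw [map_mul, map_pow, aeval_X, map_mul (aeval f) w (minpoly E f), hμf, mul_zero] at h'
    exact h'

end Character

/-! ### A point of a commutative algebra of endomorphisms has a simultaneous eigenvector -/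

section Point

variable {E V : Type*} [Field E] [AddCommGroup V] [Module E V] [FiniteDimensional E V]

/-- **A point of a commutative algebra of endomorphisms is the eigensystem of a non-zero common
eigenvector.**  For a commutative subalgebra `A ⊆ End_E(V)` (`V` finite-dimensional over the
field `E`) and an `E`-algebra homomorphism `x : A → E`, there is `v ≠ 0` in `V` with
`a v = x(a) v` for every `a ∈ A` — the maximal ideal `ker x` of the finite `E`-algebra `A` lies in
the support of the FAITHFUL `A`-module `V` (the step "`𝕋` acts faithfully, hence the eigensystem
occurs" of [cite: Hida1994AIF, Thm. 3.2] and [cite: KhareThorne2017, §6.5 Lemma 6.17]). -/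
theorem exists_ne_zero_forall_apply_eq_smul_of_algHom (A : Subalgebra E (Module.End E V))
    (hA : ∀ a b : A, Commute a b) (x : A →ₐ[E] E) :
    ∃ v : V, v ≠ 0 ∧ ∀ a : A, (a : Module.End E V) v = x a • v := by
  classical
  haveI : FiniteDimensional E A :=
    FiniteDimensional.finiteDimensional_submodule (Subalgebra.toSubmodule A)
  set n : ℕ := Module.finrank E A with hn
  let b : Module.Basis (Fin n) E A := Module.finBasis E A
  -- shifted basis elements, in the kernel of `x`
  set f : Fin n → A := fun i => b i - algebraMap E A (x (b i)) with hfdef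
  have hxf : ∀ i, x (f i) = 0 := fun i => by
    rw [hfdef]
    simp only [map_sub, AlgHom.commutes, Algebra.algebraMap_self, RingHom.id_apply, sub_self]
  choose e k hxe hfe _hce using fun i => exists_map_eq_one_and_pow_mul_eq_zero x (f i) (hxf i)
  -- the product of the `e i`: `x et = 1` and `f i ^ k i * et = 0` for all `i`
  have htot : ∀ s : Finset (Fin n), ∃ et : A, x et = 1 ∧ ∀ i ∈ s, f i ^ k i * et = 0 := by
    intro s
    induction s using Finset.induction_on with
    | empty => exact ⟨1, map_one x, fun i hi => absurd hi (Finset.notMem_empty i)⟩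
    | insert j s hj ih =>
      obtain ⟨et, hxet, het⟩ := ih
      refine ⟨e j * et, by rw [map_mul, hxe, hxet, one_mul], fun i hi => ?_⟩
      rcases Finset.mem_insert.1 hi with rfl | hi
      · rw [← mul_assoc, hfe, zero_mul]
      · rw [← mul_assoc, (hA (f i ^ k i) (e j)).eq, mul_assoc, het i hi, mul_zero]
  obtain ⟨et, hxet, het⟩ := htot Finset.univ
  -- `et ≠ 0` as an endomorphism: pick `v₀` with `et v₀ ≠ 0`
  obtain ⟨v₀, hv₀⟩ : ∃ v, (et : Module.End E V) v ≠ 0 := by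
    by_contra h
    push Not at h
    have h0 : et = 0 := Subtype.ext (LinearMap.ext h)
    rw [h0, map_zero] at hxet
    exact zero_ne_one hxet
  -- coercions of the relations to `End V`
  have hcoe : ∀ (a : A) (m : ℕ), (((a ^ m : A)) : Module.End E V) = (a : Module.End E V) ^ m :=
    fun a m => by simp
  have hkill : ∀ (i : Fin n) (v : V),
      ((f i : Module.End E V) ^ k i) ((et : Module.End E V) v) = 0 := fun i v => by
    have h := congrArg (fun a : A => (a : Module.End E V) v) (het i (Finset.mem_univ i))
    simpa using h
  have hcommEnd : ∀ a c : A, (a : Module.End E V) * (c : Module.End E V) =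
      (c : Module.End E V) * (a : Module.End E V) := fun a c =>
    congrArg Subtype.val (hA a c).eq
  -- common kernel vector inside the image of `et`, by induction on the set of indices
  have hQ : ∀ s : Finset (Fin n), ∃ w : V, w ≠ 0 ∧ (∃ v, w = (et : Module.End E V) v) ∧
      ∀ i ∈ s, (f i : Module.End E V) w = 0 := by
    intro s
    induction s using Finset.induction_on with
    | empty => exact ⟨_, hv₀, ⟨v₀, rfl⟩, fun i hi => absurd hi (Finset.notMem_empty i)⟩
    | insert j s hj ih =>
      obtain ⟨w, hw0, ⟨v, rfl⟩, hw⟩ := ih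
      have hex : ∃ m : ℕ, ((f j : Module.End E V) ^ m) ((et : Module.End E V) v) = 0 :=
        ⟨k j, hkill j v⟩
      have hm : ((f j : Module.End E V) ^ Nat.find hex) ((et : Module.End E V) v) = 0 :=
        Nat.find_spec hex
      have hm0 : Nat.find hex ≠ 0 := fun h => by
        rw [h, pow_zero, Module.End.one_apply] at hm
        exact hw0 hm
      refine ⟨((f j : Module.End E V) ^ (Nat.find hex - 1)) ((et : Module.End E V) v),
        Nat.find_min hex (Nat.sub_lt (Nat.pos_of_ne_zero hm0) one_pos), ?_, fun i hi => ?_⟩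
      · refine ⟨((f j : Module.End E V) ^ (Nat.find hex - 1)) v, ?_⟩
        change ((f j : Module.End E V) ^ (Nat.find hex - 1) * (et : Module.End E V)) v =
          ((et : Module.End E V) * (f j : Module.End E V) ^ (Nat.find hex - 1)) v
        rw [← hcoe, hcommEnd, hcoe]
      · rcases Finset.mem_insert.1 hi with rfl | hi
        · change ((f i : Module.End E V) * (f i : Module.End E V) ^ (Nat.find hex - 1))
            ((et : Module.End E V) v) = 0
          rw [← pow_succ', Nat.sub_add_cancel (Nat.pos_of_ne_zero hm0)]
          exact hm
        · change ((f i : Module.End E V) * (f j : Module.End E V) ^ (Nat.find hex - 1))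
            ((et : Module.End E V) v) = 0
          rw [← hcoe, hcommEnd, hcoe]
          change ((f j : Module.End E V) ^ (Nat.find hex - 1))
            ((f i : Module.End E V) ((et : Module.End E V) v)) = 0
          rw [hw i hi, map_zero]
  obtain ⟨w, hw0, -, hw⟩ := hQ Finset.univ
  refine ⟨w, hw0, fun a => ?_⟩
  -- on `w` the basis elements act by `x`
  have hb : ∀ i, (b i : Module.End E V) w = x (b i) • w := fun i => by
    have h := hw i (Finset.mem_univ i)
    rw [hfdef] at h
    change ((b i : Module.End E V) - (algebraMap E A (x (b i)) : Module.End E V)) w = 0 at h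
    rw [LinearMap.sub_apply, sub_eq_zero, Subalgebra.coe_algebraMap, Module.algebraMap_end_apply]
      at h
    exact h
  conv_lhs => rw [← b.sum_repr a]
  conv_rhs => rw [← b.sum_repr a]
  rw [map_sum, Finset.sum_smul, AddSubmonoidClass.coe_finsetSum, LinearMap.sum_apply]
  refine Finset.sum_congr rfl fun i _ => ?_
  rw [SetLike.val_smul, LinearMap.smul_apply, hb i, map_smul, smul_eq_mul, mul_smul]

end Point

end Literature.NumberTheory.Automorphic
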